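import Summits.ResolutionOfSingularities.ResolutionOfSingularities.Theorems.PurelyInseparableDim4ResConeLLightMaxContact
import Summits.ResolutionOfSingularities.ResolutionOfSingularities.Theorems.PurelyInseparableDim4ResConeLLightSlices
import Summits.ResolutionOfSingularities.ResolutionOfSingularities.Theorems.PurelyInseparableDim4ResConeLLightTransition
import Summits.ResolutionOfSingularities.ResolutionOfSingularities.Theorems.PurelyInseparableDim4ResConeLLightSliceLaw
import Summits.ResolutionOfSingularities.ResolutionOfSingularities.Theorems.PurelyInseparableDim4ResConeLLightTools
import Summits.ResolutionOfSingularities.ResolutionOfSingularities.Theorems.PurelyInseparableDim4ResConeLossFreeTwins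
import HarnessLib

/-!
# Purely inseparable four-folds — L-LIGHT KILL, part F5b: THE STATIONARY WITNESS SLICE AND ITS CORNER MONOMIAL (memo L-LIGHT-KILL-g6 §1–§4)
# (cell `res-dim4-pi`, K2(p) lane, the open loss-free `e = 3` cell; seat res-dim4-p-9 g6; filed under desk R-257)

[OURS · counted 0]  Nothing here proves any TAIL(p, d, 3), K2(7), K2(p) or resolution of singularities in dimension ≥ 4 /
characteristic `p` — NOT proved.  A statement about OUR frame's hypothetical `Step0 p` chains.  AI kernel work, weaker than expert review.

**`stationary_witness_slice`**.  For a witnessed `Step0 p` chain of ISOLATED states that from `k₀` on charts only `A`, `B`, translates only `φ`,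
keeps a letter `ν` with exponent `≥ 1` in every monomial and stays above the floor, there are: a slice index `1 ≤ v < p`, a time `K`, a
CORNER EXPONENT `x` and a COFACTOR ORDER `e ≥ 1` with `p = x + v + e`, such that from `K` on every monomial of the `x_ν^v`-slice has
`A`- and `B`-exponent `≥ x` and degree `≥ 2x + v + e`, and an `A → B` transition `k₁ ≥ K` after which the CORNER MONOMIAL
`x_A^x x_B^x x_ν^v x_φ^e` occurs in `F_{k₁+1}`.  (ν-slices F4 · free-axis witness + pigeonhole · F2 bookkeeping and TRICHOTOMY ⇒ the
witness slice is stationary · F3 row lemma twice at the transition.)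
[cite: Hauser2010, §§F–G, §I] [cite: HauserPerlega2019PRIMS, §2] [cite: CossartJannsenSaito2020, Lemma 13.2, Thm. 3.14]
bears_on: LADDER-RESOLUTION:D157-DOOR2 (res-dim4-pi · K2(p) L-light cell · stationary witness slice).  Supports
stmt-ResolutionOfSingularities-16155 (helper).
-/


set_option linter.dupNamespace false -- mandated namespace of this single-conjunct summit

noncomputable section

namespace Summit.ResolutionOfSingularities.ResolutionOfSingularities.Theorems.PIDim4

namespace ResCone

namespace LLight

open MvPolynomial Finset
open Literature.AlgebraicGeometry.Resolution
open Literature.AlgebraicGeometry.Resolution.CentreBlowup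
open Literature.AlgebraicGeometry.Resolution.Hauser2010

variable {K : Type} [Field K]

/-- **THE STATIONARY WITNESS SLICE AND ITS CORNER MONOMIAL** (module docstring). [OURS · memo L-LIGHT-KILL-g6 §1–§4]
[cite: CossartJannsenSaito2020, Lemma 13.2] [cite: Hauser2010, §§F–G, §I] [cite: HauserPerlega2019PRIMS, §2] -/
theorem stationary_witness_slice (p : ℕ) [Fact p.Prime] [CharP K p] [DecidableEq K]
    {c : ℕ → State K} {j : ℕ → Fin 4} {b : ℕ → Fin 4 → K}
    (hc : ∀ k, IsIsolated p (c k).F ∧ Step0 p (c k) (c (k + 1))) (hw : FreeTail.IsWitnessedChain p c j b)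
    {A B ν φ : Fin 4} (hAB : A ≠ B) (hAν : A ≠ ν) (hAφ : A ≠ φ) (hBν : B ≠ ν) (hBφ : B ≠ φ) (hνφ : ν ≠ φ)
    {k₀ : ℕ} (hj : ∀ k, k₀ ≤ k → j k = A ∨ j k = B) (hb : ∀ k, k₀ ≤ k → ∀ i, i ≠ φ → b k i = 0)
    (hν1 : ∀ k, k₀ ≤ k → ∀ E ∈ (c k).F.support, 1 ≤ E ν)
    (hfl : ∀ k, k₀ ≤ k → ∀ E ∈ (c k).F.support, p + 1 ≤ E.degree) :
    ∃ v ks x e k₁ : ℕ, 1 ≤ v ∧ v < p ∧ k₀ ≤ ks ∧ ks ≤ k₁ ∧ 1 ≤ e ∧ p = x + v + e ∧ j k₁ = A ∧ j (k₁ + 1) = B ∧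
      (∀ k, ks ≤ k → ∀ d ∈ (c k).F.support, d ν = v → x ≤ d A ∧ x ≤ d B ∧ 2 * x + v + e ≤ d.degree) ∧
      Finsupp.single A x + Finsupp.single B x + Finsupp.single ν v + Finsupp.single φ e ∈ (c (k₁ + 1)).F.support := by
  classical
  have hp2 : 2 ≤ p := (Fact.out : p.Prime).two_le
  -- §0 chain facts
  have hjν : ∀ k, k₀ ≤ k → j k ≠ ν := fun k hk h => by
    rcases hj k hk with h' | h'
    · exact hAν (h'.symm.trans h)
    · exact hBν (h'.symm.trans h)
  have hjφ : ∀ k, k₀ ≤ k → j k ≠ φ := fun k hk h => by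
    rcases hj k hk with h' | h'
    · exact hAφ (h'.symm.trans h)
    · exact hBφ (h'.symm.trans h)
  have hbj : ∀ k, b k (j k) = 0 := fun k => (hw k).2.1
  have hbν : ∀ k, k₀ ≤ k → b k ν = 0 := fun k hk => hb k hk ν hνφ
  have hq : ∀ k, (p : ℕ∞) ≤ ordAlong Finset.univ (c k).F := fun k => (hw k).1
  have hstep : ∀ k, c (k + 1) = CentreBlowup.step p Finset.univ (j k) (b k) (c k) := fun k => (hw k).2.2.2.2
  have hbsingle : ∀ k, k₀ ≤ k → b k = Pi.single φ (b k φ) := fun k hk => by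
    funext i
    by_cases hi : i = φ
    · rw [hi, Pi.single_eq_same]
    · rw [Pi.single_eq_of_ne hi, hb k hk i hi]
  -- both letters charted beyond every time (FT)
  have hAio : ∀ N, ∃ k, N ≤ k ∧ j k = A := fun N => by
    obtain ⟨k, hk, hne⟩ := chart_change_after hc hw (max N k₀)
    rcases hj k (le_of_max_le_right hk) with h | h
    · exact ⟨k, le_of_max_le_left hk, h⟩
    · rcases hj (k + 1) ((le_of_max_le_right hk).trans (Nat.le_succ k)) with h' | h'
      · exact ⟨k + 1, (le_of_max_le_left hk).trans (Nat.le_succ k), h'⟩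
      · exact absurd (h'.trans h.symm) hne
  have hBio : ∀ N, ∃ k, N ≤ k ∧ j k = B := fun N => by
    obtain ⟨k, hk, hne⟩ := chart_change_after hc hw (max N k₀)
    rcases hj k (le_of_max_le_right hk) with h | h
    · rcases hj (k + 1) ((le_of_max_le_right hk).trans (Nat.le_succ k)) with h' | h'
      · exact absurd (h'.trans h.symm) hne
      · exact ⟨k + 1, (le_of_max_le_left hk).trans (Nat.le_succ k), h'⟩
    · exact ⟨k, le_of_max_le_left hk, h⟩
  -- §1 the slices and their law
  set S : ℕ → ℕ → MvPolynomial (Fin 4) K := fun v k => ∑ d ∈ (c k).F.support with d ν = v, monomial d (coeff d (c k).F) with hS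
  have hSsupp : ∀ v k E, E ∈ (S v k).support ↔ E ∈ (c k).F.support ∧ E ν = v := fun v k E => by rw [hS]; exact mem_support_slicePoly
  have hSlaw : ∀ v, ¬ p ∣ v → ∀ k, k₀ ≤ k →
      S v (k + 1) = chartTransform p Finset.univ (j k) (Hauser2010.shear (j k) (Pi.single φ (b k φ)) (S v k)) := by
    intro v hv k hk
    have h := slicePoly_step p (hjν k hk).symm (hbj k) (hbν k hk) (c k) (hq k) hv
    rw [← hstep k] at h
    rw [hS]
    simp only
    rw [h, ← hbsingle k hk]
  -- §2 witnesses and the witness slice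
  have hwit : ∀ k, k₀ ≤ k → ∃ E ∈ (c k).F.support, E A + E B + E ν < p := fun k hk => by
    obtain ⟨E, hE, hlt⟩ := exists_free_axis_witness (hc k).1 φ
    exact ⟨E, hE, by rwa [degIn_erase_eq hAB hAν hAφ hBν hBφ hνφ] at hlt⟩
  have hvw : ∀ k, ∃ v, k₀ ≤ k → v < p ∧ ∃ E ∈ (c k).F.support, E ν = v ∧ E A + E B + E ν < p := fun k => by
    by_cases hk : k₀ ≤ k
    · obtain ⟨E, hE, hlt⟩ := hwit k hk
      exact ⟨E ν, fun _ => ⟨by omega, E, hE, rfl, hlt⟩⟩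
    · exact ⟨0, fun h => absurd h hk⟩
  choose vw hvw using hvw
  obtain ⟨vs, hvsp, hvio⟩ := exists_colour_io (v := vw) (p := p) (k₀ := k₀) fun k hk => (hvw k hk).1
  -- witness times of the slice `vs`
  have hW : ∀ N, ∃ k, N ≤ k ∧ k₀ ≤ k ∧ ∃ E ∈ (c k).F.support, E ν = vs ∧ E A + E B + vs < p := fun N => by
    obtain ⟨k, hk, hk₀, hkv⟩ := hvio N
    obtain ⟨-, E, hE, hEν, hlt⟩ := hvw k hk₀
    exact ⟨k, hk, hk₀, E, hE, hEν.trans hkv, by rw [← hkv, ← hEν]; exact hlt⟩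
  have hvs1 : 1 ≤ vs := by
    obtain ⟨k, -, hk₀, E, hE, hEν, -⟩ := hW 0
    rw [← hEν]; exact hν1 k hk₀ E hE
  have hvsdvd : ¬ p ∣ vs := fun h => by have := Nat.le_of_dvd (by omega) h; omega
  -- the slice `G k := S vs k` is non-zero from `k₀` on
  set G : ℕ → MvPolynomial (Fin 4) K := S vs with hG
  have hGlaw : ∀ k, k₀ ≤ k → G (k + 1) = chartTransform p Finset.univ (j k) (Hauser2010.shear (j k) (Pi.single φ (b k φ)) (G k)) :=
    hSlaw vs hvsdvd
  have hGsupp : ∀ k E, E ∈ (G k).support ↔ E ∈ (c k).F.support ∧ E ν = vs := hSsupp vs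
  have hGne : ∀ k, k₀ ≤ k → (G k).support.Nonempty := by
    intro k hk
    by_contra h0
    rw [Finset.not_nonempty_iff_eq_empty, MvPolynomial.support_eq_empty] at h0
    -- zero propagates forward, but a later witness time has a monomial in the slice
    have hzero : ∀ k', k ≤ k' → G k' = 0 := by
      intro k' hk'
      induction k', hk' using Nat.le_induction with
      | base => exact h0
      | succ k' hk' ih =>
        rw [hGlaw k' (hk.trans hk'), ih]
        unfold Hauser2010.shear
        rw [map_zero, chartTransform_zero]
    obtain ⟨k', hk', -, E, hE, hEν, -⟩ := hW k
    have hmem : E ∈ (G k').support := (hGsupp k' E).mpr ⟨hE, hEν⟩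
    rw [hzero k' hk', MvPolynomial.support_zero] at hmem
    exact Finset.notMem_empty E hmem
  -- §3 the bookkeeping `(o, αA, αB)` of the slice
  have hexo : ∀ k, ∃ o : ℕ, k₀ ≤ k → (∀ d ∈ (G k).support, o ≤ d.degree) ∧ ∃ d ∈ (G k).support, d.degree = o := fun k => by
    by_cases hk : k₀ ≤ k
    · obtain ⟨d, hd, hmin⟩ := Finset.exists_min_image _ Finsupp.degree (hGne k hk)
      exact ⟨d.degree, fun _ => ⟨hmin, d, hd, rfl⟩⟩
    · exact ⟨0, fun h => absurd h hk⟩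
  have hexα : ∀ i : Fin 4, ∀ k, ∃ a : ℕ, k₀ ≤ k → (∀ d ∈ (G k).support, a ≤ d i) ∧ ∃ d ∈ (G k).support, d i = a := fun i k => by
    by_cases hk : k₀ ≤ k
    · obtain ⟨d, hd, hmin⟩ := Finset.exists_min_image _ (fun d => d i) (hGne k hk)
      exact ⟨d i, fun _ => ⟨hmin, d, hd, rfl⟩⟩
    · exact ⟨0, fun h => absurd h hk⟩
  choose o ho using hexo
  choose α hα using hexα
  -- basic inequalities
  have hGν : ∀ k, ∀ d ∈ (G k).support, d ν = vs := fun k d hd => ((hGsupp k d).mp hd).2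
  have hop : ∀ k, k₀ ≤ k → p + 1 ≤ o k := fun k hk => by
    obtain ⟨d, hd, hdo⟩ := (ho k hk).2
    rw [← hdo]; exact hfl k hk d ((hGsupp k d).mp hd).1
  have hosum : ∀ k, k₀ ≤ k → α A k + α B k + vs ≤ o k := fun k hk => by
    obtain ⟨d, hd, hdo⟩ := (ho k hk).2
    have hA' := (hα A k hk).1 d hd; have hB' := (hα B k hk).1 d hd; have hν' := hGν k d hd
    have h4 : d A + d B + d ν ≤ d.degree := by
      rw [← degIn_erase_eq hAB hAν hAφ hBν hBφ hνφ d, ← degIn_univ]; exact degIn_mono (Finset.erase_subset _ _) d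
    omega
  -- the one-step recursions (F2)
  have hrec : ∀ k, k₀ ≤ k → ∀ a a' : Fin 4, j k = a → (a' = A ∨ a' = B) → a' ≠ a →
      α a (k + 1) = o k - p ∧ α a' (k + 1) = α a' k ∧ o (k + 1) + α a k ≤ 2 * o k - p := by
    intro k hk a a' hja ha' haa'
    have hk1 : k₀ ≤ k + 1 := by omega
    have haφ : a ≠ φ := hja ▸ hjφ k hk
    have haν : a ≠ ν := hja ▸ hjν k hk
    have ha'φ : a' ≠ φ := by rcases ha' with rfl | rfl <;> assumption
    have hlow := slice_step_lower (p := p) (t := b k φ) haφ haν hνφ.symm haa'.symm ha'φ (hGν k) (ho k hk).1 (hα a' k hk).1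
    have htop := slice_step_top (p := p) (t := b k φ) haφ (ho k hk).1 (ho k hk).2 (hα a k hk).1 (by have := hop k hk; omega)
    have hoth := slice_step_other (p := p) (t := b k φ) (αi := α a' k) haφ haa'.symm ha'φ (ho k hk).1 (hα a' k hk).2
      (by have := hop k hk; omega)
    have hGl := hGlaw k hk
    rw [hja] at hGl
    rw [← hGl] at hlow htop hoth
    obtain ⟨d₁, hd₁, hd₁j, hd₁deg⟩ := htop
    refine ⟨?_, ?_, ?_⟩
    · exact min_unique (hα a (k + 1) hk1).1 (hα a (k + 1) hk1).2 (fun d hd => (hlow d hd).2.1) ⟨d₁, hd₁, hd₁j⟩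
    · exact min_unique (hα a' (k + 1) hk1).1 (hα a' (k + 1) hk1).2 (fun d hd => (hlow d hd).2.2) hoth
    · have := (ho (k + 1) hk1).1 d₁ hd₁; omega
  -- the cofactor order never increases
  have hanti : ∀ k, k₀ ≤ k → (fun k => o k - (α A k + α B k + vs)) (k + 1) ≤ (fun k => o k - (α A k + α B k + vs)) k := by
    intro k hk
    have h1 := hosum k hk; have h2 := hosum (k + 1) (by omega)
    show o (k + 1) - (α A (k + 1) + α B (k + 1) + vs) ≤ o k - (α A k + α B k + vs)
    rcases hj k hk with hja | hjb
    · obtain ⟨h3, h4, h5⟩ := hrec k hk A B hja (Or.inr rfl) hAB.symm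
      omega
    · obtain ⟨h3, h4, h5⟩ := hrec k hk B A hjb (Or.inl rfl) hAB
      omega
  obtain ⟨K₁, hK₁, heconst⟩ := eventually_constant_of_antitone (e := fun k => o k - (α A k + α B k + vs)) hanti
  obtain ⟨ee, hee⟩ : ∃ ee : ℕ, o K₁ - (α A K₁ + α B K₁ + vs) = ee := ⟨_, rfl⟩
  have hec : ∀ k, K₁ ≤ k → o k - (α A k + α B k + vs) = ee := fun k hk => (heconst k hk).trans hee
  -- §3b the corner dynamics and the trichotomy
  set x : ℤ := (p : ℤ) - vs - ee with hx
  have hdynA : ∀ k, K₁ ≤ k → j k = A →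
      ((α A (k + 1) : ℤ) - x = ((α A k : ℤ) - x) + ((α B k : ℤ) - x)) ∧ ((α B (k + 1) : ℤ) - x = (α B k : ℤ) - x) := by
    intro k hk hja
    obtain ⟨h3, h4, -⟩ := hrec k (hK₁.trans hk) A B hja (Or.inr rfl) hAB.symm
    have h1 := hosum k (hK₁.trans hk); have h6 := hec k hk; have h7 := hop k (hK₁.trans hk)
    refine ⟨?_, by rw [h4]⟩
    have h8 : α A (k + 1) + p = o k := by omega
    have h9 : o k = α A k + α B k + vs + ee := by omega
    rw [hx]
    have : (α A (k + 1) : ℤ) + p = α A k + α B k + vs + ee := by exact_mod_cast h8.trans h9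
    omega
  have hdynB : ∀ k, K₁ ≤ k → ¬ j k = A →
      ((α B (k + 1) : ℤ) - x = ((α A k : ℤ) - x) + ((α B k : ℤ) - x)) ∧ ((α A (k + 1) : ℤ) - x = (α A k : ℤ) - x) := by
    intro k hk hja
    have hjb : j k = B := by
      rcases hj k (hK₁.trans hk) with h | h
      · exact absurd h hja
      · exact h
    obtain ⟨h3, h4, -⟩ := hrec k (hK₁.trans hk) B A hjb (Or.inl rfl) hAB
    have h1 := hosum k (hK₁.trans hk); have h6 := hec k hk; have h7 := hop k (hK₁.trans hk)
    refine ⟨?_, by rw [h4]⟩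
    have h8 : α B (k + 1) + p = o k := by omega
    have h9 : o k = α A k + α B k + vs + ee := by omega
    rw [hx]
    have : (α B (k + 1) : ℤ) + p = α A k + α B k + vs + ee := by exact_mod_cast h8.trans h9
    omega
  have hnA : ∀ N, ∃ k, N ≤ k ∧ ¬ j k = A := fun N => by
    obtain ⟨k, hk, hkB⟩ := hBio N; exact ⟨k, hk, by rw [hkB]; exact hAB.symm⟩
  have hbdd : ∀ k, K₁ ≤ k → -2 * x ≤ ((α A k : ℤ) - x) + ((α B k : ℤ) - x) := fun k _ => by omega
  rcases corner_trichotomy (u := fun k => (α A k : ℤ) - x) (w := fun k => (α B k : ℤ) - x) (isA := fun k => j k = A) (K₀ := K₁)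
      hdynA hdynB hAio hnA (M := -2 * x) hbdd with hstat | hesc
  swap
  · -- ESCAPING: the slice stops witnessing
    obtain ⟨N, hN⟩ := hesc ((p : ℤ) - 2 * x)
    obtain ⟨k, hk, hk₀, E, hE, hEν, hlt⟩ := hW (max N K₁)
    have hEG : E ∈ (G k).support := (hGsupp k E).mpr ⟨hE, hEν⟩
    have h1 := (hα A k hk₀).1 E hEG; have h2 := (hα B k hk₀).1 E hEG
    have h3 : (p : ℤ) - 2 * x ≤ ((α A k : ℤ) - x) + ((α B k : ℤ) - x) := hN k (le_of_max_le_left hk)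
    omega
  -- STATIONARY: `αA = αB = x` from `K₁` on
  have hxA : ∀ k, K₁ ≤ k → (α A k : ℤ) = x := fun k hk => by have h : (α A k : ℤ) - x = 0 := (hstat k hk).1; omega
  have hxB : ∀ k, K₁ ≤ k → (α B k : ℤ) = x := fun k hk => by have h : (α B k : ℤ) - x = 0 := (hstat k hk).2; omega
  obtain ⟨xn, hxn⟩ : ∃ xn : ℕ, α A K₁ = xn := ⟨_, rfl⟩
  have hxxn : x = (xn : ℤ) := by rw [← hxA K₁ le_rfl, hxn]
  have hαA : ∀ k, K₁ ≤ k → α A k = xn := fun k hk => by have := hxA k hk; rw [hxxn] at this; exact_mod_cast this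
  have hαB : ∀ k, K₁ ≤ k → α B k = xn := fun k hk => by have := hxB k hk; rw [hxxn] at this; exact_mod_cast this
  have hpve : p = xn + vs + ee := by
    have h : (p : ℤ) - vs - ee = xn := by rw [← hx, hxxn]
    have h7 := hop K₁ hK₁; have h1 := hosum K₁ hK₁; have h6 := hec K₁ le_rfl
    omega
  have hok : ∀ k, K₁ ≤ k → o k = 2 * xn + vs + ee := fun k hk => by
    have h6 := hec k hk; have h1 := hosum k (hK₁.trans hk)
    rw [hαA k hk, hαB k hk] at h1 h6; omega
  -- `1 ≤ e ≤ p − 2`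
  have he1 : 1 ≤ ee := by
    obtain ⟨k, hk, hk₀, E, hE, hEν, hlt⟩ := hW K₁
    have hEG : E ∈ (G k).support := (hGsupp k E).mpr ⟨hE, hEν⟩
    have h1 := (hα A k hk₀).1 E hEG; have h2 := (hα B k hk₀).1 E hEG
    rw [hαA k hk] at h1; rw [hαB k hk] at h2
    omega
  have hep : ee + 2 ≤ p := by have := hop K₁ hK₁; rw [hok K₁ le_rfl] at this; omega
  -- §4 the transition: `x_A^x x_B^x x_ν^{vs} x_φ^e` enters the slice
  obtain ⟨k₁, hk₁, hk₁A, hk₁B⟩ : ∃ k₁, K₁ ≤ k₁ ∧ j k₁ = A ∧ j (k₁ + 1) = B := by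
    obtain ⟨k, hk, hkB, hkB'⟩ := exists_transition (j := j) hBio (fun N => by
      obtain ⟨k, hk, hkA⟩ := hAio N; exact ⟨k, hk, by rw [hkA]; exact hAB⟩) K₁
    have hkA : j k = A := by
      rcases hj k (hK₁.trans hk) with h | h
      · exact h
      · exact absurd h hkB
    exact ⟨k, hk, hkA, hkB'⟩
  set r₀ : Fin 4 →₀ ℕ := Finsupp.single A xn + Finsupp.single B xn + Finsupp.single ν vs with hr₀
  have hsimp := And.intro hAB (And.intro hAB.symm (And.intro hAν (And.intro hAν.symm (And.intro hAφ (And.intro hAφ.symm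
    (And.intro hBν (And.intro hBν.symm (And.intro hBφ (And.intro hBφ.symm (And.intro hνφ hνφ.symm))))))))))
  have hr₀A : r₀ A = xn := by rw [hr₀]; simp [hsimp]
  have hr₀B : r₀ B = xn := by rw [hr₀]; simp [hsimp]
  have hr₀ν : r₀ ν = vs := by rw [hr₀]; simp [hsimp]
  have hr₀φ : r₀ φ = 0 := by rw [hr₀]; simp [hsimp]
  have hr₀deg : r₀.degree = 2 * xn + vs := by
    rw [hr₀, map_add, map_add, Finsupp.degree_single, Finsupp.degree_single, Finsupp.degree_single]; ring
  have hcorner : r₀ + Finsupp.single φ ee ∈ (G (k₁ + 1)).support := by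
    have hk₁0 : k₀ ≤ k₁ := hK₁.trans hk₁
    -- step k₁ (A): the row leader `m*` of a minimal-degree monomial
    obtain ⟨m0, hm0, hm0o⟩ := (ho k₁ hk₁0).2
    have hpresA : ∀ d' ∈ (chartTransform p Finset.univ A (Hauser2010.shear A (Pi.single φ (b k₁ φ)) (G k₁))).support,
        2 * o k₁ ≤ d'.degree + p + xn := by
      intro d' hd'
      rw [← hk₁A, ← hGlaw k₁ hk₁0] at hd'
      have h := (ho (k₁ + 1) (by omega)).1 d' hd'
      rw [hok (k₁ + 1) (by omega)] at h; rw [hok k₁ hk₁]; omega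
    have hlead := row_lead_mem_support (p := p) (t := b k₁ φ) hAφ (ho k₁ hk₁0).1 (fun d hd => (hαA k₁ hk₁) ▸ (hα A k₁ hk₁0).1 d hd)
      (by have := hop k₁ hk₁0; omega) hpresA hm0 hm0o
    set ms : Fin 4 →₀ ℕ := (m0.update A xn).update φ (m0 A + m0 φ - xn) with hms
    have hxm0 : xn ≤ m0 A := (hαA k₁ hk₁) ▸ (hα A k₁ hk₁0).1 m0 hm0
    have hmsA : ms A = xn := by rw [hms, Finsupp.coe_update, Function.update_of_ne hAφ, Finsupp.coe_update, Function.update_self]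
    have hmsφ : ms φ = m0 A + m0 φ - xn := by rw [hms, Finsupp.coe_update, Function.update_self]
    have hmsB : ms B = m0 B := by
      rw [hms, Finsupp.coe_update, Function.update_of_ne hBφ, Finsupp.coe_update, Function.update_of_ne hAB.symm]
    have hmsν : ms ν = vs := by
      rw [hms, Finsupp.coe_update, Function.update_of_ne hνφ, Finsupp.coe_update, Function.update_of_ne hAν.symm, hGν k₁ m0 hm0]
    have hmsdeg : ms.degree = o k₁ := by
      have h1 := PointBlowup.degree_update_add (m0.update A xn) φ (m0 A + m0 φ - xn)
      have h2 := PointBlowup.degree_update_add m0 A xn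
      rw [Finsupp.coe_update, Function.update_of_ne hAφ.symm] at h1
      rw [hms]; omega
    -- its child in the slice at `k₁ + 1`: A-exponent `xn`, degree `o (k₁+1)`
    set mc : Fin 4 →₀ ℕ := chartExponent p Finset.univ A ms with hmc
    have hdegs : ∀ d ∈ (Hauser2010.shear A (Pi.single φ (b k₁ φ)) (G k₁)).support, p ≤ d.degree := by
      intro d hd
      obtain ⟨m', hm', l, hl, rfl⟩ := exists_of_mem_support_shear_single hAφ (b k₁ φ) (G k₁) hd
      rw [degree_shear_target hAφ m' hl]
      have := (ho k₁ hk₁0).1 m' hm'; have := hop k₁ hk₁0; omega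
    have hmc_mem : mc ∈ (G (k₁ + 1)).support := by
      rw [hGlaw k₁ hk₁0, hk₁A, MvPolynomial.mem_support_iff, hmc,
        coeff_chartTransform_chartExponent_of_le hdegs (by rw [hmsdeg]; have := hop k₁ hk₁0; omega),
        coeff_shear_single_eq_self hAφ]
      · exact MvPolynomial.mem_support_iff.mp hlead
      · intro l hl1 hlj
        by_contra hne
        have h := (hα A k₁ hk₁0).1 _ (MvPolynomial.mem_support_iff.mpr hne)
        rw [hαA k₁ hk₁, Finsupp.coe_update, Function.update_of_ne hAφ, Finsupp.coe_update, Function.update_self, hmsA] at h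
        omega
    have hmcA : mc A = xn := by rw [hmc, chartExponent_apply_self, degIn_univ, hmsdeg, hok k₁ hk₁]; omega
    have hmcB : mc B = m0 B := by rw [hmc, chartExponent_apply_of_ne p Finset.univ hAB.symm, hmsB]
    have hmcν : mc ν = vs := by rw [hmc, chartExponent_apply_of_ne p Finset.univ hAν.symm, hmsν]
    have hmcφ : mc φ = m0 A + m0 φ - xn := by rw [hmc, chartExponent_apply_of_ne p Finset.univ hAφ.symm, hmsφ]
    have hmcdeg : mc.degree = o (k₁ + 1) := by
      have h := degree_chartExponent_univ p A (e := ms) (by rw [hmsdeg]; have := hop k₁ hk₁0; omega)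
      rw [← hmc, hmsA, hmsdeg] at h; rw [hok (k₁ + 1) (by omega)]; rw [hok k₁ hk₁] at h; omega
    -- step k₁ + 1 (B): the row leader of `mc`
    have hpresB : ∀ d' ∈ (chartTransform p Finset.univ B (Hauser2010.shear B (Pi.single φ (b (k₁ + 1) φ)) (G (k₁ + 1)))).support,
        2 * o (k₁ + 1) ≤ d'.degree + p + xn := by
      intro d' hd'
      rw [← hk₁B, ← hGlaw (k₁ + 1) (by omega)] at hd'
      have h := (ho (k₁ + 2) (by omega)).1 d' hd'
      rw [hok (k₁ + 2) (by omega)] at h; rw [hok (k₁ + 1) (by omega)]; omega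
    have hlead2 := row_lead_mem_support (p := p) (t := b (k₁ + 1) φ) hBφ (ho (k₁ + 1) (by omega)).1
      (fun d hd => (hαB (k₁ + 1) (by omega)) ▸ (hα B (k₁ + 1) (by omega)).1 d hd) (by have := hop (k₁ + 1) (by omega); omega)
      hpresB hmc_mem hmcdeg
    have hexp : (mc.update B xn).update φ (mc B + mc φ - xn) = r₀ + Finsupp.single φ ee := by
      have hm0deg : m0.degree = m0 A + m0 B + m0 ν + m0 φ := by
        rw [← degIn_erase_eq hAB hAν hAφ hBν hBφ hνφ m0, ← degIn_univ]
        unfold degIn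
        rw [← Finset.add_sum_erase Finset.univ _ (Finset.mem_univ φ)]; ring
      have hm0ν := hGν k₁ m0 hm0
      have hxB0 : xn ≤ m0 B := (hαB k₁ hk₁) ▸ (hα B k₁ hk₁0).1 m0 hm0
      ext i
      rw [Finsupp.add_apply, Finsupp.single_apply]
      by_cases hiφ : i = φ
      · subst hiφ
        rw [Finsupp.coe_update, Function.update_self, if_pos rfl, hr₀φ, hmcB, hmcφ, zero_add]
        have := hok k₁ hk₁; rw [← hm0o] at this; omega
      · rw [Finsupp.coe_update, Function.update_of_ne hiφ, if_neg (Ne.symm hiφ), add_zero]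
        by_cases hiB : i = B
        · subst hiB; rw [Finsupp.coe_update, Function.update_self, hr₀B]
        · rw [Finsupp.coe_update, Function.update_of_ne hiB]
          by_cases hiA : i = A
          · subst hiA; rw [hmcA, hr₀A]
          · by_cases hiν : i = ν
            · subst hiν; rw [hmcν, hr₀ν]
            · exfalso; rcases letters_exhaust hAB hAν hAφ hBν hBφ hνφ i with h | h | h | h <;> contradiction
    rw [hexp] at hlead2
    exact hlead2
  -- packaging
  refine ⟨vs, K₁, xn, ee, k₁, hvs1, hvsp, hK₁, hk₁, he1, hpve, hk₁A, hk₁B, fun k hk d hd hdν => ?_, ?_⟩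
  · have hdG : d ∈ (G k).support := (hGsupp k d).mpr ⟨hd, hdν⟩
    have h1 := (hα A k (hK₁.trans hk)).1 d hdG; have h2 := (hα B k (hK₁.trans hk)).1 d hdG
    have h3 := (ho k (hK₁.trans hk)).1 d hdG
    rw [hαA k hk] at h1; rw [hαB k hk] at h2; rw [hok k hk] at h3
    exact ⟨h1, h2, h3⟩
  · exact ((hGsupp (k₁ + 1) _).mp hcorner).1

end LLight

end ResCone

end Summit.ResolutionOfSingularities.ResolutionOfSingularities.Theorems.PIDim4

end
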